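import Literature.NumberTheory.DiophantineGeometry.AbcStewartYu2001PlaceBoundsProofs
import HarnessLib

/-!
# Stewart–Yu 2001, Theorem 2 from the place bounds, III: the endgame for bounds with `Y²`

`Literature/NumberTheory/DiophantineGeometry/AbcStewartYu2001EndgameProofs.lean` — proofs companion
(theorems only; no definition, no named fact) of `AbcStewartYu2001.lean` (named fact
`stewartYu2001_thm2` = Stewart–Yu 2001, Theorem 2 [cite: StewartYu2001, Theorem 2]).

Parts I–II (`AbcStewartYu2001PlaceBoundsAnalysis.lean`, `AbcStewartYu2001PlaceBoundsProofs.lean`)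
prove the theorem from the three place bounds of the Theorem-1 door, whose archimedean member is
the MANY-LOGARITHM bound `log c − log a < Θ_{bc} · Y` (fed by `cⁿ`-type estimates: Matveev). A
door built instead on a Kummer-conditioned archimedean estimate for FEW grouped logarithms
(Waldschmidt 1980, as in `Literature.Barriers.ABC.BakerMethodBounds_of_placeBounds_kummerArchBound₂`)
pays the height of the grouped generator `p`-adically and ends, regime by regime, in a bound of
the shape `log c < p′ · G^{C₁ log₃ G⋆ / log₂ G} · Y²` with `Y = log max{e, 2 log c}` (two
logarithmic factors instead of one). This file proves the ENDGAME for that shape, once and for all: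

* `StewartYu2001.stewartYu2001_thm2_of_bound` — if for some `C₁ > 0` every abc triple with `c > 2`
  satisfies `log c < p′ · G^{thm2Exponent C₁ G} · Y²`, then `stewartYu2001_thm2` (with the constant
  `C₁ + 2 (log(9 + 2C₁) + 4) / log₃ 16`).

The proof is the self-improvement `X < A · (log max{e, 2X})² ⇒ X < A · (7 + 2 log A)²`
(`lt_mul_sq_log_of_lt`, via `(log u)² ≤ 16 √u`), `log A ≤ log G + C₁ E` (`p′ ≤ G`,
`E = log G · log₃ G⋆ / log₂ G ≤ log G`), and the absorption
`((9 + 2C₁) log G)² ≤ G^{C₂ log₃ G⋆ / log₂ G}` (`log₂ G ≤ 4 log G / log₂ G`, `E ≥ log₃ 16`).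
Elementary real analysis ([folklore]); the statement it serves is the printed Theorem 2
[cite: Gyory2008, p. 282 (1.3), p. 287 (3.12)–(3.13)].

## References

* [StewartYu2001] C. L. Stewart, K. Yu, *On the abc conjecture, II*, Duke Math. J. 108 (2001),
  169–181 — Theorem 2.
* [Gyory2008] K. Győry, Acta Arith. 133 (2008), 281–295 — p. 282 (1.3), p. 287.
* [Waldschmidt1980] M. Waldschmidt, Acta Arith. 37 (1980) — Prop. 3.8 (the few-logarithm input).
-/

noncomputable section

open Finset Real
open Literature.Barriers.ABC
open Literature.NumberTheory.DiophantineGeometry.Dioph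
open Literature.NumberTheory.DiophantineGeometry.Pasten

namespace Literature.NumberTheory.DiophantineGeometry

namespace StewartYu2001

/-- `log₃ 16 ≤ log₃ max(G, 16)`. [folklore] -/
private theorem log₃_sixteen_le' (G : ℝ) :
    Real.log (Real.log (Real.log 16)) ≤ Real.log (Real.log (Real.log (max G 16))) := by
  have h16 : (16 : ℝ) ≤ max G 16 := le_max_right _ _
  have hlog16 : 1 < Real.log 16 := by
    rw [← Real.log_exp 1]
    refine Real.log_lt_log (Real.exp_pos 1) ?_
    have := Real.exp_one_lt_d9
    linarith
  have hll16 : 0 < Real.log (Real.log 16) := Real.log_pos hlog16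
  have h1 : Real.log 16 ≤ Real.log (max G 16) := Real.log_le_log (by norm_num) h16
  have h2 : Real.log (Real.log 16) ≤ Real.log (Real.log (max G 16)) :=
    Real.log_le_log (by linarith) h1
  exact Real.log_le_log hll16 h2

/-- `log₃ max(G, 16) ≤ log₂ G` for `G ≥ 6` (`log max(G,16) ≤ G`). [folklore] -/
private theorem log₃_le_log₂ {G : ℝ} (hG : 6 ≤ G) :
    Real.log (Real.log (Real.log (max G 16))) ≤ Real.log (Real.log G) := by
  have hG0 : 0 < G := by linarith
  have h16 : Real.log (max G 16) ≤ G := by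
    rcases le_or_gt G 16 with h | h
    · rw [max_eq_right h]
      have h4 : Real.log 16 = 4 * Real.log 2 := by
        rw [show (16 : ℝ) = 2 ^ 4 by norm_num, Real.log_pow]; norm_num
      rw [h4]
      have := Real.log_two_lt_d9
      linarith
    · rw [max_eq_left h.le]
      linarith [Real.log_le_sub_one_of_pos hG0]
  have h1 : Real.log 16 ≤ Real.log (max G 16) := Real.log_le_log (by norm_num) (le_max_right G 16)
  have h16' : 1 < Real.log 16 := by
    rw [← Real.log_exp 1]
    exact Real.log_lt_log (Real.exp_pos 1) (by have := Real.exp_one_lt_d9; linarith)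
  have hpos : 0 < Real.log (max G 16) := by linarith
  have h2 : Real.log (Real.log (max G 16)) ≤ Real.log G := Real.log_le_log hpos h16
  have hll : 0 < Real.log (Real.log (max G 16)) := Real.log_pos (by linarith)
  exact Real.log_le_log hll h2

/-- `log L ≤ 4 L / log L` for `L > 1`. [folklore] -/
private theorem log_le_four_mul_div_log' {L : ℝ} (hL : 1 < L) :
    Real.log L ≤ 4 * L / Real.log L := by
  have hL0 : 0 < L := by linarith
  have hu0 : 0 < Real.log L := Real.log_pos hL
  rw [le_div_iff₀ hu0]
  have h := Real.log_le_rpow_div hL0.le (by norm_num : (0 : ℝ) < 1 / 2)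
  have h1 : Real.log L ≤ 2 * Real.sqrt L := by
    have h2 : L ^ (1 / 2 : ℝ) / (1 / 2) = 2 * Real.sqrt L := by rw [Real.sqrt_eq_rpow]; ring
    linarith [h2]
  calc Real.log L * Real.log L ≤ (2 * Real.sqrt L) * (2 * Real.sqrt L) :=
        mul_le_mul h1 h1 hu0.le (by positivity)
    _ = 4 * (Real.sqrt L * Real.sqrt L) := by ring
    _ = 4 * L := by rw [Real.mul_self_sqrt hL0.le]

/-- **Self-improvement with two logarithmic factors:** `X < A · (log max{e, 2X})²` with `A ≥ 1`
forces `X < A · (7 + 2 log A)²` (first `(log u)² ≤ 16 √u` gives `u = 2X < 1024 A²`, then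
substitute back). [folklore] -/
private theorem lt_mul_sq_log_of_lt {A X : ℝ} (hA : 1 ≤ A)
    (h : X < A * Real.log (max (Real.exp 1) (2 * X)) ^ 2) :
    X < A * (7 + 2 * Real.log A) ^ 2 := by
  have hA0 : 0 < A := by linarith
  have hlogA : 0 ≤ Real.log A := Real.log_nonneg hA
  rcases le_or_gt (2 * X) (Real.exp 1) with hsmall | hbig
  · rw [max_eq_left hsmall, Real.log_exp, one_pow, mul_one] at h
    have h49 : (49 : ℝ) ≤ (7 + 2 * Real.log A) ^ 2 := by nlinarith
    nlinarith
  · rw [max_eq_right hbig.le] at h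
    have hu0 : 0 < 2 * X := lt_trans (Real.exp_pos 1) hbig
    have hu1 : 1 ≤ 2 * X := by
      have := Real.exp_one_gt_d9
      linarith
    have hlog0 : 0 ≤ Real.log (2 * X) := Real.log_nonneg hu1
    -- `(log u)² ≤ 16 √u`
    have hlog4 : Real.log (2 * X) ≤ 4 * (2 * X) ^ (1 / 4 : ℝ) := by
      have h1 := Real.log_le_rpow_div hu0.le (by norm_num : (0 : ℝ) < 1 / 4)
      have h2 : (2 * X) ^ (1 / 4 : ℝ) / (1 / 4) = 4 * (2 * X) ^ (1 / 4 : ℝ) := by ring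
      linarith [h2]
    have hsq : Real.log (2 * X) ^ 2 ≤ 16 * Real.sqrt (2 * X) := by
      have h14 : 0 ≤ (2 * X) ^ (1 / 4 : ℝ) := Real.rpow_nonneg hu0.le _
      calc Real.log (2 * X) ^ 2 ≤ (4 * (2 * X) ^ (1 / 4 : ℝ)) ^ 2 := pow_le_pow_left₀ hlog0 hlog4 2
        _ = 16 * ((2 * X) ^ (1 / 4 : ℝ)) ^ 2 := by ring
        _ = 16 * Real.sqrt (2 * X) := by
            rw [← Real.rpow_mul_natCast hu0.le, Real.sqrt_eq_rpow]; norm_num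
    -- `u < 32 A √u`, so `√u < 32 A`, `u < 1024 A²`
    have hsu0 : 0 < Real.sqrt (2 * X) := Real.sqrt_pos.mpr hu0
    have h4 : 2 * X < 32 * A * Real.sqrt (2 * X) := by
      have := mul_le_mul_of_nonneg_left hsq (by linarith : (0 : ℝ) ≤ 2 * A)
      nlinarith
    have h3 : Real.sqrt (2 * X) < 32 * A := by
      have h6 : Real.sqrt (2 * X) * Real.sqrt (2 * X) < 32 * A * Real.sqrt (2 * X) := by
        rw [Real.mul_self_sqrt hu0.le]; exact h4
      exact lt_of_mul_lt_mul_right h6 hsu0.le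
    have h7 : 2 * X < 1024 * A ^ 2 := by
      calc 2 * X = Real.sqrt (2 * X) * Real.sqrt (2 * X) := (Real.mul_self_sqrt hu0.le).symm
        _ < (32 * A) * (32 * A) := mul_self_lt_mul_self hsu0.le h3
        _ = 1024 * A ^ 2 := by ring
    -- `log u ≤ 7 + 2 log A`
    have h8 : Real.log (2 * X) ≤ 7 + 2 * Real.log A := by
      have h9 : Real.log (2 * X) < Real.log (1024 * A ^ 2) := Real.log_lt_log hu0 h7
      rw [Real.log_mul (by norm_num) (pow_pos hA0 2).ne', Real.log_pow] at h9
      have h10 : Real.log 1024 < 7 := by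
        rw [Real.log_lt_iff_lt_exp (by norm_num)]
        have he : (2.7 : ℝ) < Real.exp 1 := by have := Real.exp_one_gt_d9; linarith
        have h7' : Real.exp 7 = Real.exp 1 ^ 7 := by rw [← Real.exp_nat_mul]; norm_num
        have h27 : (2.7 : ℝ) ^ 7 < Real.exp 1 ^ 7 := pow_lt_pow_left₀ he (by norm_num) (by norm_num)
        rw [h7']
        linarith [show (1024 : ℝ) < 2.7 ^ 7 by norm_num]
      push_cast at h9
      linarith
    have h11 : Real.log (2 * X) ^ 2 ≤ (7 + 2 * Real.log A) ^ 2 := pow_le_pow_left₀ hlog0 h8 2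
    calc X < A * Real.log (2 * X) ^ 2 := h
      _ ≤ A * (7 + 2 * Real.log A) ^ 2 := mul_le_mul_of_nonneg_left h11 hA0.le

/-- **Endgame for Theorem 2 with two logarithmic factors.** If for some `C₁ > 0` every coprime
positive `a + b = c` with `c > 2` satisfies
`log c < p′ · G^{C₁ log₃ G⋆ / log₂ G} · (log max{e, 2 log c})²` (`p′ = min{P(a), P(b), P(c)}`,
`G = rad(abc)`, `G⋆ = max(G, 16)`), then `stewartYu2001_thm2` holds (with
`C = C₁ + 2 (log(9 + 2C₁) + 4) / log₃ 16`): self-improvement (`lt_mul_sq_log_of_lt`),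
`log(p′ G^{C₁ s}) ≤ (1 + C₁) log G`, and `((9 + 2C₁) log G)² ≤ G^{C₂ log₃ G⋆ / log₂ G}`. This is the
last step of a Theorem-2 door whose archimedean input is a few-logarithm (Kummer) estimate paid
`p`-adically, cf. the module docstring. [cite: StewartYu2001, Theorem 2]
[cite: Gyory2008, p. 282 (1.3)] -/
theorem stewartYu2001_thm2_of_bound {C₁ : ℝ} (hC₁ : 0 < C₁)
    (h : ∀ a b c : ℕ, IsABCTriple a b c → 2 < c →
      Real.log c < pmin a b c * (rad a b c : ℝ) ^ thm2Exponent C₁ (rad a b c) *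
        Real.log (max (Real.exp 1) (2 * Real.log c)) ^ 2) :
    stewartYu2001_thm2 := by
  set ℓ₀ : ℝ := Real.log (Real.log (Real.log 16)) with hℓ₀def
  have hℓ₀ : 0 < ℓ₀ := log_log_log_pos le_rfl
  have hlc : 0 ≤ Real.log (9 + 2 * C₁) := Real.log_nonneg (by linarith)
  set C₂ : ℝ := 2 * (Real.log (9 + 2 * C₁) + 4) / ℓ₀ with hC₂def
  have hC₂ : 0 ≤ C₂ := by positivity
  rw [stewartYu2001_thm2_iff]
  refine ⟨C₁ + C₂, by positivity, fun a b c ht hc => ?_⟩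
  have hb := h a b c ht hc
  obtain ⟨ha, hb0, habc, hcop⟩ := id ht
  have habc0 : a * b * c ≠ 0 := by positivity
  have hc0 : (0 : ℝ) < c := by exact_mod_cast (show 0 < c by omega)
  -- `p′ ≤ G`
  have hpminle : (pmin a b c : ℝ) ≤ (rad a b c : ℝ) := by
    have hcne : c.primeFactors.Nonempty := Nat.nonempty_primeFactors.mpr (by omega)
    have hPc := largestPrimeFactor_mem hcne
    have hPc' : largestPrimeFactor c ≤ rad a b c :=
      prime_le_rad (Nat.prime_of_mem_primeFactors hPc)
        ((Nat.dvd_of_mem_primeFactors hPc).trans (Dvd.intro_left (a * b) rfl)) habc0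
    have h1 : pmin a b c ≤ largestPrimeFactor c := by
      rw [pmin_def]; exact (min_le_right _ _).trans (min_le_right _ _)
    exact_mod_cast h1.trans hPc'
  set G : ℝ := (rad a b c : ℝ) with hGdef
  set L := Real.log G with hLdef
  set u := Real.log L with hudef
  set ℓ := Real.log (Real.log (Real.log (max G 16))) with hℓdef
  set Y := Real.log (max (Real.exp 1) (2 * Real.log c)) with hYdef
  set X := Real.log c with hXdef
  set p : ℝ := (pmin a b c : ℝ) with hpdef
  have hG6 : 6 ≤ G := by rw [hGdef]; exact_mod_cast six_le_rad ht hc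
  have hG0 : 0 < G := by linarith
  have hL1 : 1 < L := by
    rw [hLdef, Real.lt_log_iff_exp_lt hG0]
    have := Real.exp_one_lt_d9
    linarith
  have hL0 : 0 < L := by linarith
  have hu0 : 0 < u := Real.log_pos hL1
  have hℓ : ℓ₀ ≤ ℓ := log₃_sixteen_le' G
  have hℓpos : 0 < ℓ := lt_of_lt_of_le hℓ₀ hℓ
  have hℓu : ℓ ≤ u := log₃_le_log₂ hG6
  have hp1 : 1 ≤ p := by rw [hpdef]; exact_mod_cast one_le_pmin a b c
  have hp0 : 0 < p := by linarith
  -- the unit `E = L ℓ / u`: `ℓ₀ ≤ ℓ₀ L/u ≤ E ≤ L`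
  set E := L * ℓ / u with hEdef
  have hE0 : 0 < E := by positivity
  have hF1 : 1 ≤ L / u := by
    rw [le_div_iff₀ hu0, one_mul]
    linarith [Real.log_le_sub_one_of_pos hL0]
  have hEF : ℓ₀ * (L / u) ≤ E := by
    calc ℓ₀ * (L / u) ≤ ℓ * (L / u) := mul_le_mul_of_nonneg_right hℓ (by positivity)
      _ = E := by rw [hEdef]; ring
  have hE1 : ℓ₀ ≤ E := le_trans (le_mul_of_one_le_right hℓ₀.le hF1) hEF
  have hEL : E ≤ L := by
    rw [hEdef, div_le_iff₀ hu0]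
    exact mul_le_mul_of_nonneg_left hℓu hL0.le
  have hu4 : u ≤ 4 * (L / u) := by
    have h1 := log_le_four_mul_div_log' hL1
    rw [mul_div_assoc] at h1
    exact h1
  -- the two powers of `G`
  have hs : thm2Exponent C₁ G = C₁ * ℓ / u := rfl
  have hs' : thm2Exponent (C₁ + C₂) G = (C₁ + C₂) * ℓ / u := rfl
  have hB : G ^ thm2Exponent C₁ G = Real.exp (C₁ * E) := by
    rw [hs, Real.rpow_def_of_pos hG0]
    show Real.exp (L * (C₁ * ℓ / u)) = Real.exp (C₁ * E)
    congr 1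
    rw [hEdef]; ring
  have hB' : G ^ thm2Exponent (C₁ + C₂) G = Real.exp (C₁ * E) * Real.exp (C₂ * E) := by
    rw [hs', Real.rpow_def_of_pos hG0, ← Real.exp_add]
    show Real.exp (L * ((C₁ + C₂) * ℓ / u)) = Real.exp (C₁ * E + C₂ * E)
    congr 1
    rw [hEdef]; ring
  -- self-improvement with `A = p′ e^{C₁ E}`
  set A := p * Real.exp (C₁ * E) with hAdef
  have hA1 : 1 ≤ A := one_le_mul_of_one_le_of_one_le hp1 (Real.one_le_exp (by positivity))
  have hA0 : 0 < A := by linarith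
  have hXA : X < A * Y ^ 2 := by rw [hAdef, ← hB]; exact hb
  have hSI : X < A * (7 + 2 * Real.log A) ^ 2 := lt_mul_sq_log_of_lt hA1 hXA
  -- `log A ≤ L + C₁ E`, so `7 + 2 log A ≤ (9 + 2 C₁) L`
  have hlogA : Real.log A ≤ L + C₁ * E := by
    rw [hAdef, Real.log_mul hp0.ne' (Real.exp_pos _).ne', Real.log_exp]
    have : Real.log p ≤ L := Real.log_le_log hp0 hpminle
    linarith
  have h72 : 7 + 2 * Real.log A ≤ (9 + 2 * C₁) * L := by
    have h1 : C₁ * E ≤ C₁ * L := mul_le_mul_of_nonneg_left hEL hC₁.le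
    have h2 : (9 + 2 * C₁) * L = 9 * L + 2 * (C₁ * L) := by ring
    rw [h2]
    linarith
  have h72' : 0 < 7 + 2 * Real.log A := by
    have := Real.log_nonneg hA1
    linarith
  -- absorption of the square
  have key : 2 * (Real.log (9 + 2 * C₁) + u) ≤ C₂ * E := by
    have h1 : Real.log (9 + 2 * C₁) ≤ Real.log (9 + 2 * C₁) * (E / ℓ₀) := by
      have h1' : 1 ≤ E / ℓ₀ := by rw [le_div_iff₀ hℓ₀, one_mul]; exact hE1
      exact le_mul_of_one_le_right hlc h1' 
    have h2 : u ≤ 4 * (E / ℓ₀) := by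
      have h2' : L / u ≤ E / ℓ₀ := by
        rw [le_div_iff₀ hℓ₀, mul_comm]
        exact hEF
      linarith [hu4]
    have h3 : C₂ * E = 2 * (Real.log (9 + 2 * C₁) * (E / ℓ₀)) + 8 * (E / ℓ₀) := by
      rw [hC₂def]; ring
    rw [h3]
    linarith
  have h920 : 0 < 9 + 2 * C₁ := by linarith
  have hcL : 0 < (9 + 2 * C₁) * L := mul_pos h920 hL0
  have hlog2 : Real.log (((9 + 2 * C₁) * L) ^ 2) = 2 * (Real.log (9 + 2 * C₁) + u) := by
    rw [Real.log_pow, Real.log_mul h920.ne' hL0.ne']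
    push_cast
    ring
  have hsq : (7 + 2 * Real.log A) ^ 2 ≤ Real.exp (C₂ * E) := by
    calc (7 + 2 * Real.log A) ^ 2 ≤ ((9 + 2 * C₁) * L) ^ 2 := pow_le_pow_left₀ h72'.le h72 2
      _ = Real.exp (Real.log (((9 + 2 * C₁) * L) ^ 2)) := (Real.exp_log (pow_pos hcL 2)).symm
      _ = Real.exp (2 * (Real.log (9 + 2 * C₁) + u)) := by rw [hlog2]
      _ ≤ Real.exp (C₂ * E) := Real.exp_le_exp.mpr key
  -- finish
  rw [← Real.log_lt_iff_lt_exp hc0]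
  show X < p * G ^ thm2Exponent (C₁ + C₂) G
  rw [hB']
  calc X < A * (7 + 2 * Real.log A) ^ 2 := hSI
    _ ≤ A * Real.exp (C₂ * E) := mul_le_mul_of_nonneg_left hsq hA0.le
    _ = p * (Real.exp (C₁ * E) * Real.exp (C₂ * E)) := by rw [hAdef]; ring

end StewartYu2001

end Literature.NumberTheory.DiophantineGeometry

end
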